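import Summits.CriticalPhenomena.PercolationContinuityZ3.Theorems.PercNearOneGluingNoHeavyLowerTailSahiOneStepFreeOdd
import HarnessLib

/-!
# `(2′)` for EVERY product measure, conditionally on the one-pivot step inequality (STEP-ALL)

Support file (prover prim-ineq-prove-3 gen 53; `--supports stmt-CriticalPhenomena-4575`; memo
`run/shared/lean/prim/prim-ineq-prove-3/FINDING-G53-ONE-ODD.md` §9–§10).  No definitions, no named facts, no sorries, no `native_decide`.

Gen 19's step lemma `osN_ind_ind_nonneg_of_step` derives `0 ≤ n(H; A, B)` from the two sections at a pivot `e` and ONE inequality `0 ≤ M₂(A,B;e)`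
(its hypothesis `hM2`: a bilinear expression in the measures of the sections of `A`, `B` and of the slot).  Gen 53 found (memo §9–§10; exhaustive for
cubes of dimension ≤ 4 at several density vectors, random and adversarial censuses up to dimension 7, all known extremal 'hair' pairs) that `M₂ ≥ 0`
appears to hold at EVERY pivot, for EVERY pair of increasing events and EVERY product measure ("STEP-ALL").  This file records the reduction:

**`osN_threshold_nonneg_all_of_stepAll`** — if, for the given density vector `p`, the step inequality holds for every block `insert e G`, every
threshold and all increasing `insert e G`-determined `A, B`, then `0 ≤ n_p(Th_t(F); A, B)` for EVERY block `F`, threshold `t` and increasing `F`-determined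
`A, B` — i.e. the `(2′)` half of Kahn C5 / Sahi C₃ for the Hamming-threshold slot at the density vector `p` (plain induction on `F`).
So the programme's target `(2′) ∀p` is reduced to the single explicit inequality STEP-ALL (a CONDITIONAL result; STEP-ALL is open).
-/

noncomputable section

namespace Summit.CriticalPhenomena.PercolationContinuityZ3.Theorems

namespace SahiOneStep

open MeasureTheory Finset
open Literature.Probability.Percolation (DeterminedBy determinedBy_iff)
open Literature.Probability.LatticeModels (prodBernoulli)
open Literature.Probability.Percolation.DecisionTree (ind)
open SahiE3Sections (determinedBy_section_insert determinedBy_section_sdiff)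
open scoped Classical

variable {ι : Type*} [Fintype ι]

/-- **`(2′)` AT A DENSITY VECTOR `p` FROM STEP-ALL AT `p`** (memo §10): if gen 19's one-pivot step inequality `0 ≤ M₂(A,B;e)` holds for every block
`insert e G` (`e ∉ G`), every threshold `t` and all increasing `insert e G`-determined `A, B`, then `0 ≤ n_p(Th_t(F); A, B)` for every `F`, `t` and all
increasing `F`-determined `A, B`. [this work] -/
theorem osN_threshold_nonneg_all_of_stepAll (p : ι → unitInterval)
    (hstep : ∀ (G : Finset ι) (e : ι), e ∉ G → ∀ (t : ℕ) (A B : Set (Set ι)), IsUpperSet A → IsUpperSet B →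
      DeterminedBy A (↑(insert e G) : Set ι) → DeterminedBy B (↑(insert e G) : Set ι) →
      0 ≤
      ((prodBernoulli p).real {ω : Set ι | ω \ {e} ∈ A} - (prodBernoulli p).real ({ω : Set ι | ω \ {e} ∈ {ω : Set ι | t ≤ ((insert e G).filter (· ∈ ω)).card}} ∩ {ω : Set ι | ω \ {e} ∈ A})) *
          ((prodBernoulli p).real {ω : Set ι | insert e ω ∈ B} - (prodBernoulli p).real ({ω : Set ι | insert e ω ∈ {ω : Set ι | t ≤ ((insert e G).filter (· ∈ ω)).card}} ∩ {ω : Set ι | insert e ω ∈ B}))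
        + ((prodBernoulli p).real {ω : Set ι | insert e ω ∈ A} - (prodBernoulli p).real ({ω : Set ι | insert e ω ∈ {ω : Set ι | t ≤ ((insert e G).filter (· ∈ ω)).card}} ∩ {ω : Set ι | insert e ω ∈ A})) *
          ((prodBernoulli p).real {ω : Set ι | ω \ {e} ∈ B} - (prodBernoulli p).real ({ω : Set ι | ω \ {e} ∈ {ω : Set ι | t ≤ ((insert e G).filter (· ∈ ω)).card}} ∩ {ω : Set ι | ω \ {e} ∈ B}))
        + (1 - (prodBernoulli p).real {ω : Set ι | ω \ {e} ∈ {ω : Set ι | t ≤ ((insert e G).filter (· ∈ ω)).card}}) *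
          (prodBernoulli p).real ({ω : Set ι | insert e ω ∈ {ω : Set ι | t ≤ ((insert e G).filter (· ∈ ω)).card}} ∩ {ω : Set ι | insert e ω ∈ A} ∩ {ω : Set ι | insert e ω ∈ B})
        + (1 - (prodBernoulli p).real {ω : Set ι | insert e ω ∈ {ω : Set ι | t ≤ ((insert e G).filter (· ∈ ω)).card}}) *
          (prodBernoulli p).real ({ω : Set ι | ω \ {e} ∈ {ω : Set ι | t ≤ ((insert e G).filter (· ∈ ω)).card}} ∩ {ω : Set ι | ω \ {e} ∈ A} ∩ {ω : Set ι | ω \ {e} ∈ B})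
        - ((prodBernoulli p).real {ω : Set ι | insert e ω ∈ {ω : Set ι | t ≤ ((insert e G).filter (· ∈ ω)).card}} - (prodBernoulli p).real {ω : Set ι | ω \ {e} ∈ {ω : Set ι | t ≤ ((insert e G).filter (· ∈ ω)).card}}) *
          (prodBernoulli p).real {ω : Set ι | insert e ω ∈ A} * (prodBernoulli p).real {ω : Set ι | insert e ω ∈ B}
        - (1 - (prodBernoulli p).real {ω : Set ι | insert e ω ∈ {ω : Set ι | t ≤ ((insert e G).filter (· ∈ ω)).card}}) *
          ((prodBernoulli p).real {ω : Set ι | insert e ω ∈ A} * (prodBernoulli p).real {ω : Set ι | ω \ {e} ∈ B}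
            + (prodBernoulli p).real {ω : Set ι | ω \ {e} ∈ A} * (prodBernoulli p).real {ω : Set ι | insert e ω ∈ B}))
    (F : Finset ι) (t : ℕ) {A B : Set (Set ι)} (hA : IsUpperSet A) (hB : IsUpperSet B)
    (hAF : DeterminedBy A (↑F : Set ι)) (hBF : DeterminedBy B (↑F : Set ι)) :
    0 ≤ osN p {ω : Set ι | t ≤ (F.filter (· ∈ ω)).card} (ind A) (ind B) := by
  induction F using Finset.induction_on generalizing t A B with
  | empty =>
    have hagree : ∀ ω : Set ι, (∅ : Set ι) ∩ (↑(∅ : Finset ι) : Set ι) = ω ∩ ↑(∅ : Finset ι) := fun ω => by simp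
    by_cases h : (∅ : Set ι) ∈ A
    · have hAu : A = Set.univ := Set.eq_univ_of_forall fun ω => ((determinedBy_iff _ _).1 hAF ∅ ω (hagree ω)).1 h
      rw [hAu]; exact (osN_ind_ind_univ_left p _ _).symm.le
    · have hAe : A = ∅ := Set.eq_empty_of_forall_notMem fun ω hω => h (((determinedBy_iff _ _).1 hAF ∅ ω (hagree ω)).2 hω)
      rw [hAe]; exact (osN_ind_ind_empty_left p _ _).symm.le
  | insert e G heG ih =>
    have hcoe : (↑(insert e G) : Set ι) \ {e} = ↑G := by
      ext i
      simp only [Set.mem_sdiff, Finset.coe_insert, Set.mem_insert_iff, Finset.mem_coe, Set.mem_singleton_iff]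
      constructor
      · rintro ⟨h | h, hne⟩
        · exact absurd h hne
        · exact h
      · intro h
        exact ⟨Or.inr h, fun hie => heG (hie ▸ h)⟩
    have hHup : IsUpperSet {ω : Set ι | t ≤ ((insert e G).filter (· ∈ ω)).card} := isUpperSet_threshold _ _
    refine osN_ind_ind_nonneg_of_step p _ A B e ?_ ?_ (hstep G e heG t A B hA hB hAF hBF) ?_ ?_ ?_
    · cases t with
      | zero =>
        have : {ω : Set ι | insert e ω ∈ {ω : Set ι | 0 ≤ ((insert e G).filter (· ∈ ω)).card}} = {ω : Set ι | 0 ≤ (G.filter (· ∈ ω)).card} := by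
          ext ω; simp only [Set.mem_setOf_eq, zero_le]
        rw [this]
        exact ih 0 (isUpperSet_section_insert hA e) (isUpperSet_section_insert hB e)
          (hcoe ▸ determinedBy_section_insert hAF e) (hcoe ▸ determinedBy_section_insert hBF e)
      | succ t =>
        rw [section_insert_threshold heG]
        exact ih t (isUpperSet_section_insert hA e) (isUpperSet_section_insert hB e)
          (hcoe ▸ determinedBy_section_insert hAF e) (hcoe ▸ determinedBy_section_insert hBF e)
    · cases t with
      | zero =>
        have : {ω : Set ι | ω \ {e} ∈ {ω : Set ι | 0 ≤ ((insert e G).filter (· ∈ ω)).card}} = {ω : Set ι | 0 ≤ (G.filter (· ∈ ω)).card} := by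
          ext ω; simp only [Set.mem_setOf_eq, zero_le]
        rw [this]
        exact ih 0 (isUpperSet_section_sdiff hA e) (isUpperSet_section_sdiff hB e)
          (hcoe ▸ determinedBy_section_sdiff hAF e) (hcoe ▸ determinedBy_section_sdiff hBF e)
      | succ t =>
        rw [section_sdiff_threshold heG]
        exact ih (t + 1) (isUpperSet_section_sdiff hA e) (isUpperSet_section_sdiff hB e)
          (hcoe ▸ determinedBy_section_sdiff hAF e) (hcoe ▸ determinedBy_section_sdiff hBF e)
    · exact measureReal_mono (section_sdiff_subset_section_insert hHup e)
    · exact measureReal_mono (section_sdiff_subset_section_insert hA e)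
    · exact measureReal_mono (section_sdiff_subset_section_insert hB e)

end SahiOneStep

end Summit.CriticalPhenomena.PercolationContinuityZ3.Theorems
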